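import Literature.AlgebraicGeometry.HodgeTheory.HodgeSheafComap
import Literature.AlgebraicGeometry.Modules.PullbackUnitSections
import Literature.AlgebraicGeometry.Modules.PushforwardLinear
import Literature.AlgebraicGeometry.Modules.FiniteType
import Literature.AlgebraicGeometry.Modules.IsoOfSectionsOnBasis
import Literature.AlgebraicGeometry.Motives.DifferentialsProofs
import Literature.AlgebraicGeometry.Motives.HodgeSheavesProofs
import Mathlib.AlgebraicGeometry.Morphisms.FormallyUnramified
import Mathlib.RingTheory.Unramified.Basic
import Mathlib.RingTheory.Kaehler.Basic
import HarnessLib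

/-!
# `dg` on `q`-forms in PULL-BACK form, `g^*Ω^q_{X₁/S} ⟶ Ω^q_{X₀/S}`, and its surjectivity for an unramified `g`

Layer `Literature/AlgebraicGeometry/HodgeTheory`; companion of `HodgeSheafComap.lean`, which constructs the pull-back of `q`-forms
along a morphism `g : X₀ ⟶ X₁` of `S`-schemes in ADJOINT form `g^♯ : Ω^q_{X₁} ⟶ g_*Ω^q_{X₀}` and lists «Not here: the pull-back form
`g^*Ωʲ_{X₁} → Ωʲ_{X₀}`». This file supplies the pull-back form and the first half of Hartshorne II Prop. 8.11 ∕ III Prop. 10.4 for it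
(everything PROVED; one `def`, no named fact):

* `pullbackForms g q : g^*Ω^q_{X₁} ⟶ Ω^q_{X₀}` — the transpose of `hodgeSheaf.comap g q` under Mathlib's `pullbackPushforwardAdjunction`,
  with the transpose identity `pullbackForms_app_unitSection` (`dg(η(ω)) = g^♯ω` on the pulled-back sections `η(ω)` of
  `Modules/PullbackUnitSections`);
* `span_dSection_appLE_eq_top` — **an UNRAMIFIED morphism pulls back enough `1`-forms**: on affine `U ⊆ g⁻¹V` with
  `Γ(V, 𝒪_{X₁}) → Γ(U, 𝒪_{X₀})` formally unramified, `Γ(U, Ω¹_{X₀/S})` is spanned over `Γ(U, 𝒪)` by the `d(g♯b)`, `b ∈ Γ(V, 𝒪_{X₁})`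
  (Mathlib: `Ω_{B/A} = 0` for `A → B` formally unramified and the exact sequence `B ⊗_A Ω_{A/S} → Ω_{B/S} → Ω_{B/A} → 0`,
  `KaehlerDifferential.range_mapBaseChange`; the tree's `Γ(U, Ω¹) = Ω_{Γ(U)/S}` on affines, `bijective_toCotangentSheaf_app_holds`);
* `surjective_pullbackForms_app`, **`epi_pullbackForms`** — for `g` formally unramified (and the affine sections of `Ω¹_{X₀}` free on
  a basis, e.g. `Ω¹_{X₀}` locally free), `dg : g^*Ω^q_{X₁} ⟶ Ω^q_{X₀}` is SURJECTIVE on the sections over the unramified affine charts,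
  hence an EPIMORPHISM (`⋀^q` of the span statement slot by slot — `AlternatingMap.mem_of_forall_mem_span` — through
  `Γ(U, Ω^q) = (⋀^q Γ(U, Ω¹))^sh`, `bijective_toHodgeSheaf_app`, and `epi_of_surjective_on_basis`). This is the surjectivity half of
  «`g` étale ⇒ `g^*Ω_{Y} ≅ Ω_X`» (Hartshorne III Prop. 10.4 ∕ II Prop. 8.11 with `Ω_{X/Y} = 0`); injectivity for an isogeny of a
  complex abelian variety is obtained on the Summits side from it by a rank argument
  (`Summits/HodgeConjecture/…/VHCAbelianSchemesRoadIsogenyPullbackFormsIso.lean`).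

Motivation: the Hodge road's data node (L7b) `IsogenyTwistPushforwardIso` (crux stmt-HodgeConjecture-26512) carries a `dite` on
`IsIso (dg)`; this file and its Summits companion collapse it.

## References
* [Hartshorne1977] R. Hartshorne, Algebraic Geometry (1977), II Prop. 8.11, II Remark 8.9.2, II Ex. 5.16 (e), III Prop. 10.4.
* [StacksProject] The Stacks project, Tag 00UO (formally unramified ⇔ `Ω_{S/R} = 0`), Tag 00WN.
-/

noncomputable section

-- `TopCat.Presheaf`/`Scheme.Modules` are not reducible (as in Mathlib's `AlgebraicGeometry/Modules/Sheaf.lean`).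
set_option backward.isDefEq.respectTransparency false

open CategoryTheory CategoryTheory.Limits AlgebraicGeometry Opposite TopologicalSpace
open AlgebraicGeometry.Scheme.Modules

namespace Literature.AlgebraicGeometry.HodgeTheory

open Literature.AlgebraicGeometry.Modules Literature.AlgebraicGeometry.Motives

/-! ## §1 Algebra: an alternating map lands in a submodule if it does so on tuples from a spanning set -/

section Alternating

variable {R M N : Type*} [CommRing R] [AddCommGroup M] [Module R M] [AddCommGroup N] [Module R N] {q : ℕ}

/-- An `R`-alternating map in `q` variables whose values on all tuples drawn from a spanning set `P` lie in a submodule `Q` takes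
ALL its values in `Q` (slot-by-slot induction: in each slot the map is linear). [cite: Hartshorne1977, II Ex. 5.16 (exterior powers: pure wedges of generators generate)] -/
theorem AlternatingMap.mem_of_forall_mem_span (f : M [⋀^Fin q]→ₗ[R] N) {P : Set M} (hP : Submodule.span R P = ⊤)
    (Q : Submodule R N) (h : ∀ ρ : Fin q → M, (∀ i, ρ i ∈ P) → f ρ ∈ Q) (θ : Fin q → M) : f θ ∈ Q := by
  -- `S k`: the claim for tuples whose slots `≥ k` are in `P`
  suffices hS : ∀ k : ℕ, ∀ θ : Fin q → M, (∀ i : Fin q, k ≤ i.val → θ i ∈ P) → f θ ∈ Q from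
    hS q θ fun i hi => absurd i.isLt (not_lt.mpr hi)
  intro k
  induction k with
  | zero => exact fun θ hθ => h θ fun i => hθ i (Nat.zero_le _)
  | succ k ih =>
    intro θ hθ
    by_cases hk : k < q
    · -- vary slot `k`: the map `x ↦ f (update θ k x)` is linear and lands in `Q` on `P`, hence on `span P = ⊤`
      let i₀ : Fin q := ⟨k, hk⟩
      let L : M →ₗ[R] N := f.toMultilinearMap.toLinearMap θ i₀
      have hL : ∀ x, L x = f (Function.update θ i₀ x) := fun x => rfl
      have hsub : Submodule.span R P ≤ Q.comap L := by
        rw [Submodule.span_le]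
        intro x hx
        change L x ∈ Q
        rw [hL]
        refine ih _ fun i hi => ?_
        by_cases hii : i = i₀
        · subst hii
          rwa [Function.update_self]
        · rw [Function.update_of_ne hii]
          refine hθ i ?_
          have : i.val ≠ k := fun hh => hii (Fin.ext hh)
          omega
      have hmem : θ i₀ ∈ Q.comap L := hsub (hP ▸ Submodule.mem_top)
      change L (θ i₀) ∈ Q at hmem
      rwa [hL, Function.update_eq_self] at hmem
    · exact ih θ fun i hi => hθ i (by omega)

end Alternating

/-! ## §2 `dg` on `q`-forms for a morphism of `S`-schemes: definition, transpose identity -/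

section PullbackForms

universe u

variable {S : Type u} [CommRing S] {X₀ X₁ : Over (Spec (CommRingCat.of S))} (g : X₀ ⟶ X₁) (q : ℕ)

/-- **`dg` on `q`-forms** for a morphism `g : X₀ ⟶ X₁` of `S`-schemes: the `𝒪_{X₀}`-linear map `g^*Ω^q_{X₁} ⟶ Ω^q_{X₀}`
adjoint (Mathlib `pullbackPushforwardAdjunction`) to the pull-back of forms `g^♯ : Ω^q_{X₁} ⟶ g_*Ω^q_{X₀}` (the tree's
`hodgeSheaf.comap`). [cite: Hartshorne1977, II Prop. 8.11 and II Ex. 5.16 (e)] -/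
def pullbackForms : (Scheme.Modules.pullback g.left).obj (hodgeSheaf X₁ q) ⟶ hodgeSheaf X₀ q :=
  ((Scheme.Modules.pullbackPushforwardAdjunction g.left).homEquiv _ _).symm (hodgeSheaf.comap g q)

/-- **Transpose identity**: `dg` applied to the pulled-back section `η(ω) ∈ Γ(g⁻¹V, g^*Ω^q_{X₁})` of a `q`-form `ω ∈ Γ(V, Ω^q_{X₁})`
is `g^♯ω ∈ Γ(g⁻¹V, Ω^q_{X₀})`. [cite: Hartshorne1977, II §5 p. 110 (f^* ⊣ f_*) and II Prop. 8.11] -/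
theorem pullbackForms_app_unitSection (V : X₁.left.Opens) (ω : Γ(hodgeSheaf X₁ q, V)) :
    (pullbackForms g q).app (g.left ⁻¹ᵁ V) (unitSection g.left (hodgeSheaf X₁ q) V ω) =
      (hodgeSheaf.comap g q).app V ω := by
  have h := (Scheme.Modules.pullbackPushforwardAdjunction g.left).homEquiv_unit (X := hodgeSheaf X₁ q)
    (Y := hodgeSheaf X₀ q) (f := pullbackForms g q)
  rw [show (Scheme.Modules.pullbackPushforwardAdjunction g.left).homEquiv _ _ (pullbackForms g q) =
      hodgeSheaf.comap g q from Equiv.apply_symm_apply _ _] at h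
  rw [h]
  rfl

end PullbackForms

/-! ## §3 Unramified morphisms pull back enough `1`-forms: `Γ(U, Ω¹_{X₀}) = Γ(U,𝒪)·{d(g♯b)}` on affine charts -/

section Unramified

universe u

variable {S : Type u} [CommRing S] {X₀ X₁ : Over (Spec (CommRingCat.of S))} (g : X₀ ⟶ X₁)

/-- The structure maps to `S` are compatible with `g♯` on charts: `g♯_{V→U}(c|_V) = c|_U` for `c ∈ S`, `U ≤ g⁻¹V` (`g` is a
morphism OVER `Spec S`). [cite: Hartshorne1977, II Prop. 8.11 (morphisms of S-schemes)] -/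
theorem appLE_constToPresheaf (V : X₁.left.Opens) (U : X₀.left.Opens) (hUV : U ≤ g.left ⁻¹ᵁ V) (c : S) :
    g.left.appLE V U hUV ((constToPresheaf X₁).app (op V) c) = (constToPresheaf X₀).app (op U) c := by
  have h₁ : (constToPresheaf X₁).app (op V) c =
      X₁.left.presheaf.map (homOfLE (le_top : V ≤ ⊤)).op (scalarRingHomTop X₁ c) := by
    rw [scalarRingHomTop_apply]; rfl
  have h₀ : (constToPresheaf X₀).app (op U) c =
      X₀.left.presheaf.map (homOfLE (le_top : U ≤ ⊤)).op (scalarRingHomTop X₀ c) := by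
    rw [scalarRingHomTop_apply]; rfl
  rw [h₁, h₀, Scheme.Hom.appLE, CommRingCat.comp_apply, app_scalarRingHomTop_res g V c,
    ← CommRingCat.comp_apply, ← Functor.map_comp]
  rfl

variable {g}

/-- **An unramified morphism pulls back enough `1`-forms**: if `U ⊆ g⁻¹V` are affine opens with `Γ(V, 𝒪_{X₁}) → Γ(U, 𝒪_{X₀})`
formally unramified, then `Γ(U, Ω¹_{X₀/S})` is spanned over `Γ(U, 𝒪_{X₀})` by the differentials `d(g♯b)`, `b ∈ Γ(V, 𝒪_{X₁})`
(`Ω_{B/S} = B·dA` for `A → B` formally unramified: the sequence `B ⊗_A Ω_{A/S} → Ω_{B/S} → Ω_{B/A} = 0`, Mathlib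
`KaehlerDifferential.range_mapBaseChange` + `Algebra.FormallyUnramified.subsingleton_kaehlerDifferential`, through
`Γ(U, Ω¹) = Ω_{Γ(U)/S}` on the affine `U`, the tree's `bijective_toCotangentSheaf_app_holds`).
[cite: Hartshorne1977, II Prop. 8.11 and II Remark 8.9.2] [cite: StacksProject, Tag 00UO] -/
theorem span_dSection_appLE_eq_top {V : X₁.left.Opens} {U : X₀.left.Opens} (hU : IsAffineOpen U) (hUV : U ≤ g.left ⁻¹ᵁ V)
    (hunr : (g.left.appLE V U hUV).hom.FormallyUnramified) :
    Submodule.span Γ(X₀.left, U) (Set.range fun b : Γ(X₁.left, V) => dSection X₀ U (g.left.appLE V U hUV b)) = ⊤ := by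
  classical
  -- the algebra structures `S → Γ(V) → Γ(U)`
  letI algU : Algebra S Γ(X₀.left, U) := (((constToPresheaf X₀).app (op U)).hom : S →+* Γ(X₀.left, U)).toAlgebra
  letI algV : Algebra S Γ(X₁.left, V) := (((constToPresheaf X₁).app (op V)).hom : S →+* Γ(X₁.left, V)).toAlgebra
  letI algVU : Algebra Γ(X₁.left, V) Γ(X₀.left, U) := (g.left.appLE V U hUV).hom.toAlgebra
  haveI : IsScalarTower S Γ(X₁.left, V) Γ(X₀.left, U) :=
    IsScalarTower.of_algebraMap_eq fun c => (appLE_constToPresheaf g V U hUV c).symm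
  haveI : Algebra.FormallyUnramified Γ(X₁.left, V) Γ(X₀.left, U) := hunr
  -- `Ω_{Γ(U)/S}` is spanned over `Γ(U)` by the `d(g♯ b)`
  have hΩ : ∀ ξ : Ω[Γ(X₀.left, U)⁄S],
      ξ ∈ Submodule.span Γ(X₀.left, U) (Set.range fun b : Γ(X₁.left, V) =>
        KaehlerDifferential.D S Γ(X₀.left, U) (algebraMap Γ(X₁.left, V) Γ(X₀.left, U) b)) := by
    intro ξ
    have hsurj : ξ ∈ LinearMap.range (KaehlerDifferential.mapBaseChange S Γ(X₁.left, V) Γ(X₀.left, U)) := by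
      rw [KaehlerDifferential.range_mapBaseChange, LinearMap.mem_ker]
      exact Subsingleton.elim _ _
    obtain ⟨t, rfl⟩ := hsurj
    induction t using TensorProduct.induction_on with
    | zero => rw [map_zero]; exact Submodule.zero_mem _
    | add x y hx hy => rw [map_add]; exact Submodule.add_mem _ hx hy
    | tmul u y =>
      rw [KaehlerDifferential.mapBaseChange_tmul]
      refine Submodule.smul_mem _ u ?_
      -- `y ∈ Ω_{Γ(V)/S}` is a `Γ(V)`-combination of `D b`'s; `map (D b) = D (g♯ b)`
      have hy : y ∈ Submodule.span Γ(X₁.left, V) (Set.range (KaehlerDifferential.D S Γ(X₁.left, V))) := by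
        rw [KaehlerDifferential.span_range_derivation]; exact Submodule.mem_top
      induction hy using Submodule.span_induction with
      | mem x hx =>
        obtain ⟨b, rfl⟩ := hx
        rw [KaehlerDifferential.map_D]
        exact Submodule.subset_span ⟨b, rfl⟩
      | zero => rw [map_zero]; exact Submodule.zero_mem _
      | add x y _ _ hx hy => rw [map_add]; exact Submodule.add_mem _ hx hy
      | smul a x _ hx =>
        rw [LinearMap.map_smul_of_tower, algebra_compatible_smul Γ(X₀.left, U) a]
        exact Submodule.smul_mem _ _ hx
  -- transport through `Ω_{Γ(U)/S} → Γ(U, Ω¹)` (surjective on the affine `U`), which sends `D a` to `dSection U a`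
  rw [eq_top_iff]
  rintro x -
  obtain ⟨ξ, rfl⟩ := (bijective_toCotangentSheaf_app_holds X₀ hU).2 x
  have hlin : ∀ (a : Γ(X₀.left, U)) (ζ : Ω[Γ(X₀.left, U)⁄S]),
      (toCotangentSheaf X₀).app (op U) (a • ζ) = a • (toCotangentSheaf X₀).app (op U) ζ :=
    fun a ζ => ((toCotangentSheaf X₀).app (op U)).hom.map_smul a ζ
  induction hΩ ξ using Submodule.span_induction with
  | mem y hy =>
    obtain ⟨b, rfl⟩ := hy
    exact Submodule.subset_span ⟨b, rfl⟩
  | zero => rw [map_zero]; exact Submodule.zero_mem _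
  | add y z _ _ hy hz => rw [map_add]; exact Submodule.add_mem _ hy hz
  | smul a y _ hy => rw [hlin]; exact Submodule.smul_mem _ _ hy

end Unramified

/-! ## §4 `dg` on `q`-forms is SURJECTIVE on the sections over unramified affine charts, hence an epimorphism -/

section Surjective

universe u

variable {S : Type u} [CommRing S] {X₀ X₁ : Over (Spec (CommRingCat.of S))} (g : X₀ ⟶ X₁) (q : ℕ)

/-- The sheafification map `⋀^q Γ(U, Ω¹) → Γ(U, Ω^q)` as a `Γ(U, 𝒪)`-linear map into the sections of the Hodge sheaf (retyping of
the tree's `toHodgeSheaf`). [cite: Hartshorne1977, II Ex. 5.16 (the sheaf associated to the sectionwise exterior powers)] -/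
def toHodgeSheafLinear (X : Over (Spec (CommRingCat.of S))) (U : X.left.Opens) :
    ((formsOne X).obj (op U)).exteriorPower q →ₗ[Γ(X.left, U)] Γ(hodgeSheaf X q, U) where
  toFun ω := ((toHodgeSheaf X q).app (op U) ω : Γ(hodgeSheaf X q, U))
  map_add' ω ω' := map_add ((toHodgeSheaf X q).app (op U)).hom ω ω'
  map_smul' a ω := ((toHodgeSheaf X q).app (op U)).hom.map_smul a ω

/-- Unfolding of `toHodgeSheafLinear`. [cite: Hartshorne1977, II Ex. 5.16 (the sheaf associated to the sectionwise exterior powers)] -/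
theorem toHodgeSheafLinear_apply (X : Over (Spec (CommRingCat.of S))) (U : X.left.Opens)
    (ω : ((formsOne X).obj (op U)).exteriorPower q) :
    toHodgeSheafLinear q X U ω = ((toHodgeSheaf X q).app (op U) ω : Γ(hodgeSheaf X q, U)) := rfl

variable {g q}

/-- **Restriction of a pulled-back pure wedge of exact forms**: for `b₁, …, b_q ∈ Γ(V, 𝒪_{X₁})` and `U ≤ g⁻¹V`,
`(g^♯(db₁ ∧ ⋯ ∧ db_q)^sh)|_U = (d(g♯b₁|_U) ∧ ⋯ ∧ d(g♯b_q|_U))^sh` in `Γ(U, Ω^q_{X₀})` (`g^♯` of a sheafified wedge is the sheafified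
wedge of the `g^♯θᵢ`, `g^♯(db) = d(g♯b)`, and everything commutes with restriction). [cite: Hartshorne1977, II Prop. 8.11 and II Ex. 5.16 (e)] -/
theorem map_comap_toHodgeSheaf_wedge_dSection {V : X₁.left.Opens} {U : X₀.left.Opens} (hUV : U ≤ g.left ⁻¹ᵁ V)
    (b : Fin q → Γ(X₁.left, V)) :
    (hodgeSheaf X₀ q).presheaf.map (homOfLE hUV).op
        ((hodgeSheaf.comap g q).app V ((toHodgeSheaf X₁ q).app (op V)
          (ModuleCat.exteriorPower.mk fun i => (dSection X₁ V (b i) : (formsOne X₁).obj (op V))))) =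
      ((toHodgeSheaf X₀ q).app (op U)
        (ModuleCat.exteriorPower.mk fun i =>
          (dSection X₀ U (g.left.appLE V U hUV (b i)) : (formsOne X₀).obj (op U))) : Γ(hodgeSheaf X₀ q, U)) := by
  rw [hodgeSheaf.comap_app_toHodgeSheaf, comapWedge_mk]
  have hnat := (PresheafOfModules.naturality_apply (toHodgeSheaf X₀ q) (homOfLE hUV).op
    (ModuleCat.exteriorPower.mk (M := (formsOne X₀).obj (op (g.left ⁻¹ᵁ V)))
      fun i => (comapOneApp g V (dSection X₁ V (b i)) : (formsOne X₀).obj (op (g.left ⁻¹ᵁ V))))).symm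
  refine hnat.trans ?_
  rw [← restrWedge_apply, restrWedge_mk]
  congr 2
  funext i
  change (cotangentSheaf X₀).presheaf.map (homOfLE hUV).op
      ((cotangentSheaf.comap g).app V (dSection X₁ V (b i))) = _
  rw [comap_app_dSection, map_dSection]
  rfl

/-- **`dg` hits the pulled-back pure wedges**: for `b₁, …, b_q ∈ Γ(V, 𝒪_{X₁})` and `U ≤ g⁻¹V`, the `q`-form
`(d(g♯b₁) ∧ ⋯ ∧ d(g♯b_q))^sh ∈ Γ(U, Ω^q_{X₀})` is `dg` of (the restriction to `U` of) the pulled-back section `η((db₁ ∧ ⋯ ∧ db_q)^sh)`.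
[cite: Hartshorne1977, II Prop. 8.11 and II Ex. 5.16 (e)] -/
theorem toHodgeSheaf_wedge_dSection_appLE_mem_range {V : X₁.left.Opens} {U : X₀.left.Opens} (hUV : U ≤ g.left ⁻¹ᵁ V)
    (b : Fin q → Γ(X₁.left, V)) :
    toHodgeSheafLinear q X₀ U (ModuleCat.exteriorPower.mk fun i => (dSection X₀ U (g.left.appLE V U hUV (b i)) :
        (formsOne X₀).obj (op U))) ∈ LinearMap.range (appLinear (pullbackForms g q) U) := by
  refine ⟨((Scheme.Modules.pullback g.left).obj (hodgeSheaf X₁ q)).presheaf.map (homOfLE hUV).op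
    (unitSection g.left (hodgeSheaf X₁ q) V ((toHodgeSheaf X₁ q).app (op V)
      (ModuleCat.exteriorPower.mk fun i => (dSection X₁ V (b i) : (formsOne X₁).obj (op V))))), ?_⟩
  rw [appLinear_apply, Scheme.Modules.Hom.app_map_apply, pullbackForms_app_unitSection, toHodgeSheafLinear_apply]
  exact map_comap_toHodgeSheaf_wedge_dSection hUV b

/-- **`dg : g^*Ω^q_{X₁} ⟶ Ω^q_{X₀}` is SURJECTIVE on the sections over an unramified affine chart**: for affine `U ⊆ g⁻¹V` with
`Γ(V, 𝒪_{X₁}) → Γ(U, 𝒪_{X₀})` formally unramified and `Γ(U, Ω¹_{X₀})` free, every `q`-form on `U` is in the image of `dg`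
(`⋀^q` of `Ω_{Γ(U)/S} = Γ(U,𝒪)·d(g♯Γ(V,𝒪))`, slot by slot, then `Γ(U, Ω^q) = (⋀^q Γ(U, Ω¹))^sh` on the affine `U`, the tree's
`bijective_toHodgeSheaf_app`). [cite: Hartshorne1977, II Prop. 8.11, II Ex. 5.16 (e)] [cite: StacksProject, Tag 00UO] -/
theorem surjective_pullbackForms_app {V : X₁.left.Opens} {U : X₀.left.Opens} (hU : IsAffineOpen U) (hUV : U ≤ g.left ⁻¹ᵁ V)
    (hunr : (g.left.appLE V U hUV).hom.FormallyUnramified)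
    (hfree : Module.Free Γ(X₀.left, U) Γ(cotangentSheaf X₀, U)) :
    Function.Surjective ((pullbackForms g q).app U) := by
  intro s
  let R : Submodule Γ(X₀.left, U) Γ(hodgeSheaf X₀ q, U) := LinearMap.range (appLinear (pullbackForms g q) U)
  suffices h : ∀ ω : ((formsOne X₀).obj (op U)).exteriorPower q, toHodgeSheafLinear q X₀ U ω ∈ R by
    obtain ⟨ω, hω⟩ := (bijective_toHodgeSheaf_app X₀ q hU hfree).2 s
    obtain ⟨t, ht⟩ := h ω
    exact ⟨t, ht.trans hω⟩
  intro ω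
  induction ω using formsPresheaf_induction q with
  | mk m =>
    -- slot-by-slot: the `d(g♯ b)` span `Γ(U, Ω¹_{X₀})`, and on tuples of them the wedge is hit by `dg`
    refine AlternatingMap.mem_of_forall_mem_span
      ((toHodgeSheafLinear q X₀ U).compAlternatingMap (ModuleCat.exteriorPower.mk (M := (formsOne X₀).obj (op U))))
      (span_dSection_appLE_eq_top hU hUV hunr) R (fun ρ hρ => ?_) m
    choose b hb using hρ
    have hρ' : ρ = fun i => (dSection X₀ U (g.left.appLE V U hUV (b i)) : (formsOne X₀).obj (op U)) :=
      funext fun i => (hb i).symm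
    rw [LinearMap.compAlternatingMap_apply, hρ']
    exact toHodgeSheaf_wedge_dSection_appLE_mem_range hUV b
  | zero => rw [map_zero]; exact R.zero_mem
  | add x y hx hy => rw [map_add]; exact R.add_mem hx hy
  | smul a x hx => rw [LinearMap.map_smul]; exact R.smul_mem _ hx

variable (g q)

/-- **`dg` on `q`-forms is an EPIMORPHISM for a formally unramified `g`** whose source has the affine opens with free `Γ(U, Ω¹)`
as a basis (e.g. `Ω¹_{X₀}` locally free): surjective on the sections over a basis of opens (`surjective_pullbackForms_app` on the
affine `U ⊆ g⁻¹V`, `V` affine), hence epi (the tree's `epi_of_surjective_on_basis`). [cite: Hartshorne1977, II Prop. 8.11] [cite: StacksProject, Tag 00UO] -/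
theorem epi_pullbackForms [FormallyUnramified g.left]
    (hfree : ∀ U : X₀.left.Opens, IsAffineOpen U → Module.Free Γ(X₀.left, U) Γ(cotangentSheaf X₀, U)) :
    Epi (pullbackForms g q) := by
  -- the basis: affine opens of `X₀` inside the preimage of an affine open of `X₁`
  let B : Set X₀.left.Opens := {U | IsAffineOpen U ∧ ∃ V : X₁.left.Opens, IsAffineOpen V ∧ U ≤ g.left ⁻¹ᵁ V}
  have hB : Opens.IsBasis B := by
    refine Opens.isBasis_iff_nbhd.mpr fun {W x} hx => ?_
    obtain ⟨_, ⟨V, hV, rfl⟩, hxV, -⟩ := X₁.left.isBasis_affineOpens.exists_subset_of_mem_open (Set.mem_univ (g.left.base x)) isOpen_univ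
    have hx' : x ∈ (W ⊓ g.left ⁻¹ᵁ V : X₀.left.Opens) := ⟨hx, hxV⟩
    obtain ⟨_, ⟨U, hU, rfl⟩, hxU, hUW⟩ := X₀.left.isBasis_affineOpens.exists_subset_of_mem_open hx' (W ⊓ g.left ⁻¹ᵁ V).2
    exact ⟨U, ⟨hU, V, hV, fun y hy => (hUW hy).2⟩, hxU, fun y hy => (hUW hy).1⟩
  refine epi_of_surjective_on_basis (pullbackForms g q) hB fun U ⟨hU, V, hV, hUV⟩ => ?_
  exact surjective_pullbackForms_app hU hUV
    (HasRingHomProperty.appLE (P := @FormallyUnramified) (f := g.left) (inferInstance : FormallyUnramified g.left)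
      ⟨V, hV⟩ ⟨U, hU⟩ hUV) (hfree U hU)

end Surjective

end Literature.AlgebraicGeometry.HodgeTheory

end
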